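import Mathlib.Analysis.Calculus.BumpFunction.FiniteDimension
import Mathlib.MeasureTheory.Integral.DominatedConvergence
import Literature.MathematicalPhysics.KineticTheory.InfiniteChainObservables

/-!
# Stationarity for unbounded local observables of the infinite chain, I: the cut-off argument

Helper file (`--supports stmt-AtomisticToContinuum-13980`, route `ParityLiouvilleSeed`, decl
`LiouvilleForHeat`; equally usable by the glue items `CesaroUpgrade` / `WindowLimit`).

Time invariance of a state `ν` of the infinite chain `P : OscillatorChain` is formalised in the
generator form `∫ 𝒜f dν = 0` on the PRINTED test class `C₀¹` of bounded local `C¹` functions with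
bounded derivative (`IsTimeInvariant`, Bernardin 2014 §1.1 Def. 1 footnote). Every use of it on the
physical observables — site energies, bond energies, currents: all UNBOUNDED polynomials — needs a
cut-off argument, written out here once and for all chains:

* `isLocalTestFunction_of_hasCompactSupport` — a compactly supported `C¹` profile is a `C₀¹` profile;
* scaled smooth bumps `y ↦ φ(R⁻¹ y)` of a finite-dimensional space (`ContDiffBump`): support, value
  `1` near the origin at scale `R`, derivative bound uniform in `R ≥ 1`;
* `liouvilleZ_mul_cutoff` — the box formula for `𝒜((g · θ) ∘ box)`;
* `integral_liouvilleZ_comp_boxRestrictAt_eq_zero` — **time invariance extends to every `C¹` profile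
  `g` with `𝒜(g ∘ box) ∈ L¹(ν)` and cut-off envelope `|g ∘ box| · ∑_box (|p| + |F|) ∈ L¹(ν)`**
  (dominated convergence as `R = N + 1 → ∞`);
* an elementary algebra of real functions with ALL POWER MOMENTS (`∀ n, fⁿ ∈ L¹`): closed under
  sums, products, scalars, powers, absolute values — the form in which the route's site-moment
  hypothesis `∀ m, |q_x|ᵐ + |p_x|ᵐ ∈ L¹(ν)` is consumed (`moments_of_integrable_abs_pow_add`).

Part II (`…LiouvilleForHeatObservables`) computes `𝒜` of the on-site and bond energies of
`pinnedChain` and derives the two stationarity identities; Part III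
(`…LiouvilleForHeatBondIndependence`) concludes that the mean current is bond independent.
Everything is folklore calculus; nothing here closes an item.
-/

noncomputable section

open MeasureTheory Filter Topology Set

namespace Summit.AtomisticToContinuum.FouriersLaw.Theorems.ParityLiouvilleSeed

open Literature.MathematicalPhysics.KineticTheory.HeatConduction

/-! ### A `C¹` profile with compact support is a `C₀¹` profile -/

/-- A `C¹` function with compact support on the box space is bounded with bounded derivative, hence
defines a local test function on any box. [folklore] -/
theorem isLocalTestFunction_of_hasCompactSupport (a : ℤ) (n : ℕ) {G : (Fin (n + 1) → ℝ × ℝ) → ℝ}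
    (hG : ContDiff ℝ 1 G) (hsupp : HasCompactSupport G) :
    IsLocalTestFunction (G ∘ boxRestrictAt a n) := by
  refine isLocalTestFunction_comp_boxRestrictAt a n hG ?_ ?_
  · obtain ⟨C, hC⟩ := hG.continuous.bounded_above_of_compact_support hsupp
    exact ⟨C, fun y => by simpa [Real.norm_eq_abs] using hC y⟩
  · obtain ⟨C, hC⟩ := (hG.continuous_fderiv one_ne_zero).bounded_above_of_compact_support
      (hsupp.fderiv (𝕜 := ℝ))
    exact ⟨C, hC⟩

/-! ### Scaled bump cut-offs on a finite-dimensional space -/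

section Cutoff

variable {E : Type*} [NormedAddCommGroup E] [NormedSpace ℝ E] [FiniteDimensional ℝ E]
  (φ : ContDiffBump (0 : E))

/-- The derivative of a bump function is bounded. [folklore] -/
theorem exists_norm_fderiv_bump_le : ∃ K : ℝ, 0 ≤ K ∧ ∀ y, ‖fderiv ℝ (φ : E → ℝ) y‖ ≤ K := by
  obtain ⟨K, hK⟩ := ((φ.contDiff (n := 1)).continuous_fderiv one_ne_zero).bounded_above_of_compact_support
    (φ.hasCompactSupport.fderiv (𝕜 := ℝ))
  exact ⟨max K 0, le_max_right _ _, fun y => (hK y).trans (le_max_left _ _)⟩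

/-- The scaled bump `y ↦ φ(R⁻¹ y)` is `C¹`. [folklore] -/
theorem contDiff_bump_smul (R : ℝ) : ContDiff ℝ 1 fun y : E => φ (R⁻¹ • y) :=
  (φ.contDiff (n := 1)).comp (contDiff_const_smul _)

/-- `|φ(R⁻¹ y)| ≤ 1`. [folklore] -/
theorem abs_bump_smul_le_one (R : ℝ) (y : E) : |φ (R⁻¹ • y)| ≤ 1 := by
  rw [abs_of_nonneg φ.nonneg]; exact φ.le_one

/-- The scaled bump vanishes outside the closed ball of radius `r_out R` (`R > 0`). [folklore] -/
theorem bump_smul_eq_zero {R : ℝ} (hR : 0 < R) {y : E} (hy : φ.rOut * R ≤ ‖y‖) :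
    φ (R⁻¹ • y) = 0 := by
  apply φ.zero_of_le_dist
  rw [dist_zero_right, norm_smul, norm_inv, Real.norm_eq_abs, abs_of_pos hR, le_inv_mul_iff₀ hR]
  linarith

/-- The scaled bump has compact support (`R > 0`). [folklore] -/
theorem hasCompactSupport_bump_smul {R : ℝ} (hR : 0 < R) :
    HasCompactSupport fun y : E => φ (R⁻¹ • y) := by
  refine HasCompactSupport.intro (isCompact_closedBall (0 : E) (φ.rOut * R)) ?_
  intro y hy
  rw [Metric.mem_closedBall, dist_zero_right, not_le] at hy
  exact bump_smul_eq_zero φ hR hy.le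

/-- The scaled bump is `1` near every point of the open ball of radius `r_in R`. [folklore] -/
theorem bump_smul_eventuallyEq_one {R : ℝ} (hR : 0 < R) {y : E} (hy : ‖y‖ < φ.rIn * R) :
    (fun z : E => φ (R⁻¹ • z)) =ᶠ[𝓝 y] fun _ => 1 := by
  have hopen : IsOpen {z : E | ‖z‖ < φ.rIn * R} := isOpen_lt continuous_norm continuous_const
  filter_upwards [hopen.mem_nhds hy] with z hz
  apply φ.one_of_mem_closedBall
  rw [Metric.mem_closedBall, dist_zero_right, norm_smul, norm_inv, Real.norm_eq_abs, abs_of_pos hR,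
    inv_mul_le_iff₀ hR]
  linarith

/-- Derivative bound `‖D(φ(R⁻¹ ·))‖ ≤ K` for `R ≥ 1`, `K` a bound for `‖Dφ‖`. [folklore] -/
theorem norm_fderiv_bump_smul_le {K : ℝ} (hK0 : 0 ≤ K) (hK : ∀ y, ‖fderiv ℝ (φ : E → ℝ) y‖ ≤ K)
    {R : ℝ} (hR : 1 ≤ R) (y : E) : ‖fderiv ℝ (fun z : E => φ (R⁻¹ • z)) y‖ ≤ K := by
  have hθ : DifferentiableAt ℝ (φ : E → ℝ) (R⁻¹ • y) :=
    (φ.contDiff (n := 1)).differentiable one_ne_zero _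
  have hL : HasFDerivAt (fun z : E => R⁻¹ • z) (R⁻¹ • ContinuousLinearMap.id ℝ E) y :=
    (hasFDerivAt_id y).const_smul R⁻¹
  have hcomp := hθ.hasFDerivAt.comp y hL
  have heq : (fun z : E => φ (R⁻¹ • z)) = (φ : E → ℝ) ∘ fun z => R⁻¹ • z := rfl
  rw [heq, hcomp.fderiv]
  have hR0 : 0 < R := lt_of_lt_of_le one_pos hR
  calc ‖(fderiv ℝ (φ : E → ℝ) (R⁻¹ • y)).comp (R⁻¹ • ContinuousLinearMap.id ℝ E)‖
        ≤ ‖fderiv ℝ (φ : E → ℝ) (R⁻¹ • y)‖ * ‖R⁻¹ • ContinuousLinearMap.id ℝ E‖ :=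
          ContinuousLinearMap.opNorm_comp_le _ _
    _ ≤ K * 1 := by
          refine mul_le_mul (hK _) ?_ (norm_nonneg _) hK0
          rw [norm_smul, norm_inv, Real.norm_eq_abs, abs_of_pos hR0]
          calc R⁻¹ * ‖ContinuousLinearMap.id ℝ E‖ ≤ 1 * 1 :=
                mul_le_mul (inv_le_one_of_one_le₀ hR) ContinuousLinearMap.norm_id_le (norm_nonneg _)
                  zero_le_one
            _ = 1 := one_mul _
    _ = K := mul_one _

end Cutoff

/-! ### Time invariance extends to unbounded `C¹` local observables -/

/-- Unit coordinate vectors of the box space have norm `≤ 1`. [folklore] -/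
theorem norm_single_le_one {n : ℕ} (i : Fin (n + 1)) (v : ℝ × ℝ) (hv : ‖v‖ ≤ 1) :
    ‖(Pi.single i v : Fin (n + 1) → ℝ × ℝ)‖ ≤ 1 := by
  rw [Pi.norm_single]; exact hv

/-- `|Dθ(y) e| ≤ K` for a unit coordinate vector `e` when `‖Dθ(y)‖ ≤ K`. [folklore] -/
theorem abs_fderiv_apply_single_le {n : ℕ} {θ : (Fin (n + 1) → ℝ × ℝ) → ℝ} {K : ℝ} (hK0 : 0 ≤ K)
    (hK : ∀ y, ‖fderiv ℝ θ y‖ ≤ K) (y : Fin (n + 1) → ℝ × ℝ) (i : Fin (n + 1)) (v : ℝ × ℝ)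
    (hv : ‖v‖ ≤ 1) : |fderiv ℝ θ y (Pi.single i v)| ≤ K := by
  rw [← Real.norm_eq_abs]
  calc ‖fderiv ℝ θ y (Pi.single i v)‖ ≤ ‖fderiv ℝ θ y‖ * ‖(Pi.single i v : Fin (n + 1) → ℝ × ℝ)‖ :=
        ContinuousLinearMap.le_opNorm _ _
    _ ≤ K * 1 := mul_le_mul (hK y) (norm_single_le_one i v hv) (norm_nonneg _) hK0
    _ = K := mul_one _

/-- **Box formula for a cut-off profile.** For `G = g · θ` with `g`, `θ` differentiable at the point,
`𝒜(G ∘ box)(σ) = θ(y) 𝒜(g ∘ box)(σ) + g(y) ∑_i (p_{a+i} Dθ(y)e_i^q + F_{a+i} Dθ(y)e_i^p)`,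
`y = box σ`. [folklore] -/
theorem liouvilleZ_mul_cutoff (P : OscillatorChain) (a : ℤ) (n : ℕ)
    {g θ : (Fin (n + 1) → ℝ × ℝ) → ℝ} (σ : ChainConfig)
    (hg : DifferentiableAt ℝ g (boxRestrictAt a n σ)) (hθ : DifferentiableAt ℝ θ (boxRestrictAt a n σ)) :
    liouvilleZ P ((fun y => g y * θ y) ∘ boxRestrictAt a n) σ =
      θ (boxRestrictAt a n σ) * liouvilleZ P (g ∘ boxRestrictAt a n) σ +
        g (boxRestrictAt a n σ) * ∑ i : Fin (n + 1),
          ((σ (a + i)).2 * fderiv ℝ θ (boxRestrictAt a n σ) (Pi.single i (1, 0)) +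
            P.force σ (a + i) * fderiv ℝ θ (boxRestrictAt a n σ) (Pi.single i (0, 1))) := by
  have hG : DifferentiableAt ℝ (fun y => g y * θ y) (boxRestrictAt a n σ) := hg.mul hθ
  rw [liouvilleZ_comp_boxRestrictAt P a n σ hG, liouvilleZ_comp_boxRestrictAt P a n σ hg,
    fderiv_fun_mul hg hθ, Finset.mul_sum, Finset.mul_sum, ← Finset.sum_add_distrib]
  refine Finset.sum_congr rfl fun i _ => ?_
  simp only [add_apply, FunLike.coe_smul, Pi.smul_apply, smul_eq_mul]
  ring

/-- **Time invariance extends to unbounded `C¹` local observables.** Let `ν` be time invariant for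
the chain `P` (`∫ 𝒜f dν = 0` on `C₀¹`). If `g` is ANY `C¹` profile on the box `{a, …, a+n}` such that
`𝒜(g ∘ box) ∈ L¹(ν)` and the cut-off envelope `|g(box σ)| · ∑_{i ≤ n} (|p_{a+i}| + |F_{a+i}(σ)|)` is in
`L¹(ν)`, then `∫ 𝒜(g ∘ box) dν = 0`. Proof: apply time invariance to the compactly supported profiles
`g · φ(y/R)` (`φ` a smooth bump, `R = N + 1 → ∞`) and pass to the limit by dominated convergence —
`𝒜` of the cut-off profile equals `𝒜(g ∘ box)` as soon as `R` exceeds the size of the configuration in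
the box, and is dominated by `|𝒜(g ∘ box)| + K · envelope` uniformly in `R ≥ 1`. [folklore] -/
theorem integral_liouvilleZ_comp_boxRestrictAt_eq_zero (P : OscillatorChain) {ν : Measure ChainConfig}
    (hν : IsTimeInvariant P ν) (a : ℤ) (n : ℕ) {g : (Fin (n + 1) → ℝ × ℝ) → ℝ} (hg : ContDiff ℝ 1 g)
    (hint : Integrable (liouvilleZ P (g ∘ boxRestrictAt a n)) ν)
    (henv : Integrable (fun σ => |g (boxRestrictAt a n σ)| *
      ∑ i : Fin (n + 1), (|(σ (a + i)).2| + |P.force σ (a + i)|)) ν) :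
    ∫ σ, liouvilleZ P (g ∘ boxRestrictAt a n) σ ∂ν = 0 := by
  set φ : ContDiffBump (0 : Fin (n + 1) → ℝ × ℝ) := default
  obtain ⟨K, hK0, hK⟩ := exists_norm_fderiv_bump_le φ
  -- the cut-off profiles at scale `R = N + 1`
  set θ : ℕ → (Fin (n + 1) → ℝ × ℝ) → ℝ := fun N y => φ (((N : ℝ) + 1)⁻¹ • y) with hθdef
  set G : ℕ → (Fin (n + 1) → ℝ × ℝ) → ℝ := fun N y => g y * θ N y with hGdef
  have hR1 : ∀ N : ℕ, (1 : ℝ) ≤ (N : ℝ) + 1 := fun N => by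
    have : (0 : ℝ) ≤ N := Nat.cast_nonneg N
    linarith
  have hR0 : ∀ N : ℕ, (0 : ℝ) < (N : ℝ) + 1 := fun N => lt_of_lt_of_le one_pos (hR1 N)
  have hθdiff : ∀ N, ContDiff ℝ 1 (θ N) := fun N => contDiff_bump_smul φ _
  have hGdiff : ∀ N, ContDiff ℝ 1 (G N) := fun N => hg.mul (hθdiff N)
  have hGsupp : ∀ N, HasCompactSupport (G N) := fun N =>
    (hasCompactSupport_bump_smul φ (hR0 N)).mul_left
  have hGtest : ∀ N, IsLocalTestFunction (G N ∘ boxRestrictAt a n) := fun N =>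
    isLocalTestFunction_of_hasCompactSupport a n (hGdiff N) (hGsupp N)
  have hzero : ∀ N, ∫ σ, liouvilleZ P (G N ∘ boxRestrictAt a n) σ ∂ν = 0 := fun N =>
    (hν _ (hGtest N)).2
  have hKθ : ∀ N y, ‖fderiv ℝ (θ N) y‖ ≤ K := fun N y =>
    norm_fderiv_bump_smul_le φ hK0 hK (hR1 N) y
  -- the box formula for the cut-off profiles
  have hformula : ∀ N σ, liouvilleZ P (G N ∘ boxRestrictAt a n) σ =
      θ N (boxRestrictAt a n σ) * liouvilleZ P (g ∘ boxRestrictAt a n) σ +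
        g (boxRestrictAt a n σ) * ∑ i : Fin (n + 1),
          ((σ (a + i)).2 * fderiv ℝ (θ N) (boxRestrictAt a n σ) (Pi.single i (1, 0)) +
            P.force σ (a + i) * fderiv ℝ (θ N) (boxRestrictAt a n σ) (Pi.single i (0, 1))) :=
    fun N σ => liouvilleZ_mul_cutoff P a n σ ((hg.differentiable one_ne_zero) _)
      (((hθdiff N).differentiable one_ne_zero) _)
  -- dominated convergence
  have h1 : ‖((1 : ℝ), (0 : ℝ))‖ ≤ 1 := by simp [Prod.norm_def]
  have h2 : ‖((0 : ℝ), (1 : ℝ))‖ ≤ 1 := by simp [Prod.norm_def]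
  have hlim : Tendsto (fun N => ∫ σ, liouvilleZ P (G N ∘ boxRestrictAt a n) σ ∂ν) atTop
      (𝓝 (∫ σ, liouvilleZ P (g ∘ boxRestrictAt a n) σ ∂ν)) := by
    refine tendsto_integral_of_dominated_convergence
      (fun σ => |liouvilleZ P (g ∘ boxRestrictAt a n) σ| +
        K * (|g (boxRestrictAt a n σ)| * ∑ i : Fin (n + 1), (|(σ (a + i)).2| + |P.force σ (a + i)|)))
      (fun N => ((hGtest N).measurable_liouvilleZ P).aestronglyMeasurable)
      (hint.abs.add (henv.const_mul K)) (fun N => Eventually.of_forall fun σ => ?_)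
      (Eventually.of_forall fun σ => ?_)
    · -- domination, uniformly in `N`
      rw [Real.norm_eq_abs, hformula N σ]
      refine (abs_add_le _ _).trans (add_le_add ?_ ?_)
      · rw [abs_mul]
        calc |θ N (boxRestrictAt a n σ)| * |liouvilleZ P (g ∘ boxRestrictAt a n) σ|
            ≤ 1 * |liouvilleZ P (g ∘ boxRestrictAt a n) σ| :=
              mul_le_mul_of_nonneg_right (abs_bump_smul_le_one φ _ _) (abs_nonneg _)
          _ = _ := one_mul _
      · rw [abs_mul, mul_left_comm, Finset.mul_sum]
        refine mul_le_mul_of_nonneg_left ?_ (abs_nonneg _)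
        refine (Finset.abs_sum_le_sum_abs _ _).trans (Finset.sum_le_sum fun i _ => ?_)
        calc |(σ (a + i)).2 * fderiv ℝ (θ N) (boxRestrictAt a n σ) (Pi.single i (1, 0)) +
              P.force σ (a + i) * fderiv ℝ (θ N) (boxRestrictAt a n σ) (Pi.single i (0, 1))|
            ≤ |(σ (a + i)).2| * |fderiv ℝ (θ N) (boxRestrictAt a n σ) (Pi.single i (1, 0))| +
              |P.force σ (a + i)| * |fderiv ℝ (θ N) (boxRestrictAt a n σ) (Pi.single i (0, 1))| := by
                rw [← abs_mul, ← abs_mul]; exact abs_add_le _ _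
          _ ≤ |(σ (a + i)).2| * K + |P.force σ (a + i)| * K :=
                add_le_add
                  (mul_le_mul_of_nonneg_left
                    (abs_fderiv_apply_single_le hK0 (hKθ N) _ i _ h1) (abs_nonneg _))
                  (mul_le_mul_of_nonneg_left
                    (abs_fderiv_apply_single_le hK0 (hKθ N) _ i _ h2) (abs_nonneg _))
          _ = K * (|(σ (a + i)).2| + |P.force σ (a + i)|) := by ring
    · -- pointwise: the cut-off is eventually invisible
      set y := boxRestrictAt a n σ with hy
      obtain ⟨N₀, hN₀⟩ := exists_nat_gt (‖y‖ / φ.rIn)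
      have hev : ∀ᶠ N : ℕ in atTop, liouvilleZ P (G N ∘ boxRestrictAt a n) σ =
          liouvilleZ P (g ∘ boxRestrictAt a n) σ := by
        refine eventually_atTop.2 ⟨N₀, fun N hN => ?_⟩
        have hyN : ‖y‖ < φ.rIn * ((N : ℝ) + 1) := by
          have hr := φ.rIn_pos
          rw [div_lt_iff₀ hr] at hN₀
          have hNN : (N₀ : ℝ) ≤ N := by exact_mod_cast hN
          nlinarith
        have hθ1 : θ N =ᶠ[𝓝 y] fun _ => 1 := bump_smul_eventuallyEq_one φ (hR0 N) hyN
        have hGg : G N =ᶠ[𝓝 y] g := hθ1.mono fun z hz => by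
          simp only [hGdef, hz, mul_one]
        rw [liouvilleZ_comp_boxRestrictAt P a n σ (((hGdiff N).differentiable one_ne_zero) _),
          liouvilleZ_comp_boxRestrictAt P a n σ ((hg.differentiable one_ne_zero) _), ← hy,
          hGg.fderiv_eq]
      exact tendsto_const_nhds.congr' (EventuallyEq.symm hev)
  have hlim0 : Tendsto (fun N => ∫ σ, liouvilleZ P (G N ∘ boxRestrictAt a n) σ ∂ν) atTop (𝓝 0) := by
    simp only [hzero]; exact tendsto_const_nhds
  exact tendsto_nhds_unique hlim hlim0

/-! ### Functions with all power moments: an algebra -/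

section Moments

variable {α : Type*} [MeasurableSpace α] {μ : Measure α}

/-- A function with all power moments is a.e. strongly measurable. [folklore] -/
theorem aestronglyMeasurable_of_moments {f : α → ℝ} (hf : ∀ n : ℕ, Integrable (fun a => f a ^ n) μ) :
    AEStronglyMeasurable f μ :=
  (hf 1).aestronglyMeasurable.congr (Eventually.of_forall fun a => pow_one (f a))

/-- A function with all power moments is integrable. [folklore] -/
theorem integrable_of_moments {f : α → ℝ} (hf : ∀ n : ℕ, Integrable (fun a => f a ^ n) μ) :
    Integrable f μ :=
  (hf 1).congr (Eventually.of_forall fun a => pow_one (f a))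

/-- Constants have all power moments (finite measure). [folklore] -/
theorem moments_const [IsFiniteMeasure μ] (c : ℝ) : ∀ n : ℕ, Integrable (fun _ : α => c ^ n) μ :=
  fun _ => integrable_const _

/-- All power moments are preserved by scalar multiplication. [folklore] -/
theorem moments_const_mul {f : α → ℝ} (hf : ∀ n : ℕ, Integrable (fun a => f a ^ n) μ) (c : ℝ) :
    ∀ n : ℕ, Integrable (fun a => (c * f a) ^ n) μ := fun n =>
  ((hf n).const_mul (c ^ n)).congr (Eventually.of_forall fun a => by simp only [mul_pow])

/-- All power moments are preserved by negation. [folklore] -/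
theorem moments_neg {f : α → ℝ} (hf : ∀ n : ℕ, Integrable (fun a => f a ^ n) μ) :
    ∀ n : ℕ, Integrable (fun a => (-f a) ^ n) μ := fun n =>
  (moments_const_mul hf (-1) n).congr (Eventually.of_forall fun a => by simp only [neg_one_mul])

/-- All power moments are preserved by absolute values. [folklore] -/
theorem moments_abs {f : α → ℝ} (hf : ∀ n : ℕ, Integrable (fun a => f a ^ n) μ) :
    ∀ n : ℕ, Integrable (fun a => |f a| ^ n) μ := fun n =>
  ((hf n).abs).congr (Eventually.of_forall fun a => by simp only [abs_pow])

/-- All power moments are preserved by powers. [folklore] -/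
theorem moments_pow {f : α → ℝ} (hf : ∀ n : ℕ, Integrable (fun a => f a ^ n) μ) (k : ℕ) :
    ∀ n : ℕ, Integrable (fun a => (f a ^ k) ^ n) μ := fun n =>
  (hf (k * n)).congr (Eventually.of_forall fun a => pow_mul (f a) k n)

/-- Functions with all power moments form an additive class:
`|f + g|ⁿ ≤ 2ⁿ⁻¹ (|f|ⁿ + |g|ⁿ)`. [folklore] -/
theorem moments_add {f g : α → ℝ} (hf : ∀ n : ℕ, Integrable (fun a => f a ^ n) μ)
    (hg : ∀ n : ℕ, Integrable (fun a => g a ^ n) μ) :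
    ∀ n : ℕ, Integrable (fun a => (f a + g a) ^ n) μ := by
  intro n
  have hmeas : AEStronglyMeasurable (fun a => (f a + g a) ^ n) μ :=
    ((aestronglyMeasurable_of_moments hf).add (aestronglyMeasurable_of_moments hg)).pow n
  refine ((((hf n).abs).add ((hg n).abs)).const_mul ((2 : ℝ) ^ (n - 1))).mono' hmeas
    (Eventually.of_forall fun a => ?_)
  rw [Real.norm_eq_abs, abs_pow]
  calc |f a + g a| ^ n ≤ (|f a| + |g a|) ^ n :=
        pow_le_pow_left₀ (abs_nonneg _) (abs_add_le _ _) n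
    _ ≤ 2 ^ (n - 1) * (|f a| ^ n + |g a| ^ n) := add_pow_le (abs_nonneg _) (abs_nonneg _) n
    _ = 2 ^ (n - 1) * (|f a ^ n| + |g a ^ n|) := by rw [abs_pow, abs_pow]

/-- Subtraction. [folklore] -/
theorem moments_sub {f g : α → ℝ} (hf : ∀ n : ℕ, Integrable (fun a => f a ^ n) μ)
    (hg : ∀ n : ℕ, Integrable (fun a => g a ^ n) μ) :
    ∀ n : ℕ, Integrable (fun a => (f a - g a) ^ n) μ := fun n =>
  (moments_add hf (moments_neg hg) n).congr (Eventually.of_forall fun a => by simp only [sub_eq_add_neg])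

/-- Functions with all power moments form a multiplicative class:
`|f g|ⁿ ≤ (f²ⁿ + g²ⁿ)/2`. [folklore] -/
theorem moments_mul {f g : α → ℝ} (hf : ∀ n : ℕ, Integrable (fun a => f a ^ n) μ)
    (hg : ∀ n : ℕ, Integrable (fun a => g a ^ n) μ) :
    ∀ n : ℕ, Integrable (fun a => (f a * g a) ^ n) μ := by
  intro n
  have hmeas : AEStronglyMeasurable (fun a => (f a * g a) ^ n) μ :=
    ((aestronglyMeasurable_of_moments hf).mul (aestronglyMeasurable_of_moments hg)).pow n
  have h2f : Integrable (fun a => (f a ^ n) ^ 2) μ :=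
    (hf (n * 2)).congr (Eventually.of_forall fun a => pow_mul (f a) n 2)
  have h2g : Integrable (fun a => (g a ^ n) ^ 2) μ :=
    (hg (n * 2)).congr (Eventually.of_forall fun a => pow_mul (g a) n 2)
  refine ((h2f.add h2g).div_const 2).mono' hmeas (Eventually.of_forall fun a => ?_)
  rw [Real.norm_eq_abs, mul_pow, abs_mul]
  show |f a ^ n| * |g a ^ n| ≤ ((f a ^ n) ^ 2 + (g a ^ n) ^ 2) / 2
  nlinarith [two_mul_le_add_sq |f a ^ n| |g a ^ n|, sq_abs (f a ^ n), sq_abs (g a ^ n),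
    abs_nonneg (f a ^ n), abs_nonneg (g a ^ n)]

/-- A product of two functions with all power moments is integrable. [folklore] -/
theorem integrable_mul_of_moments {f g : α → ℝ} (hf : ∀ n : ℕ, Integrable (fun a => f a ^ n) μ)
    (hg : ∀ n : ℕ, Integrable (fun a => g a ^ n) μ) : Integrable (fun a => f a * g a) μ :=
  integrable_of_moments (moments_mul hf hg)

/-- From `|f|ᵐ + |g|ᵐ ∈ L¹` for all `m` (the moment hypothesis of the route, site by site) to all
power moments of `f` and of `g`. [folklore] -/
theorem moments_of_integrable_abs_pow_add {f g : α → ℝ} (hfm : AEStronglyMeasurable f μ)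
    (hgm : AEStronglyMeasurable g μ)
    (h : ∀ m : ℕ, Integrable (fun a => |f a| ^ m + |g a| ^ m) μ) :
    (∀ n : ℕ, Integrable (fun a => f a ^ n) μ) ∧ ∀ n : ℕ, Integrable (fun a => g a ^ n) μ := by
  refine ⟨fun n => (h n).mono' (hfm.pow n) (Eventually.of_forall fun a => ?_),
    fun n => (h n).mono' (hgm.pow n) (Eventually.of_forall fun a => ?_)⟩
  · rw [Real.norm_eq_abs, abs_pow]
    exact le_add_of_nonneg_right (pow_nonneg (abs_nonneg _) _)
  · rw [Real.norm_eq_abs, abs_pow]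
    exact le_add_of_nonneg_left (pow_nonneg (abs_nonneg _) _)

end Moments

end Summit.AtomisticToContinuum.FouriersLaw.Theorems.ParityLiouvilleSeed

end
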